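import Literature.NumberTheory.LocalFields.EtaleAlgebraSquareClassesFinite    -- ★ (B6) p851678 `exists_finset_units_forall_eq_mul_sq` (square classes of a finite étale algebra over a local field)
import Literature.NumberTheory.Rogawski1990.CartanIndex                        -- ★ `cartanInvolution`, `coe_cartanInvolution` (+ ★ `HermitianAdjointCartanAlgebra`: `isReduced_adjoin_singleton`, …)
import Literature.NumberTheory.Rogawski1990.CartanTorusTransport               -- ★ (B5) p851648 `hermStar` unit lemmas (brings ★ `CartanAlgebra`)
import HarnessLib

/-!
# Finitely many `⋆`-fixed units of a Cartan algebra `L[γ₀]` modulo norms `a⋆ a` — the (NORMS) input of ★ `UnitaryCartanClassesFinite` (Rogawski 1990 §3.5 Prop. 3.5.2: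
# `H¹(F, T) ≅ Kˣ ∕ N(K′ˣ)` is finite over a local field)

Topic `NumberTheory/Rogawski1990`; namespace `Literature.NumberTheory.Rogawski1990`.  THEOREMS ONLY (no definition, no instance, no notation, no named fact, no
`sorry`); universe `Type`.  Cell `pub/hodgecm-mathlib`, crux H413 = `stmt-HodgeConjecture-24833` (supports-only lane), line LH6 «StCharTS», (S-𝔇) datum road, brick (B7a′)
«NORMS DISCHARGE» of the p03 lineage's «CARTAN-FIN (N1)» road: the hypothesis `hNorms` of ★ `exists_finset_cartanSubgroups_of_types_of_norms` over a non-archimedean local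
field `F` of characteristic `0`.

THE MATHEMATICS.  `F` a non-archimedean local field of characteristic `0`, `L ⊇ F` a finite extension with an `F`-involution `σ`, `H ∈ GL_N(L)` `σ`-hermitian, `γ₀ ∈ U(H)(L)`
regular semisimple, `B = L[γ₀]`, `τ = ⋆|_B` (★ `cartanInvolution`), `K = B^τ` (Mathlib `AlgHom.equalizer τ id`).  `K` is a REDUCED (★ `isReduced_adjoin_singleton`) finite-dimensional
commutative `F`-algebra, so by ★ (B6) its unit group has FINITELY MANY SQUARE CLASSES: `Kˣ = ⋃_{t ∈ T} t · Kˣ²`.  A `⋆`-fixed invertible `x ∈ B` is a unit OF `K` (its inverse is a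
polynomial in `γ₀`, hence in `B`, and is `⋆`-fixed), so `x = t · c²` with `c ∈ Kˣ`, and `c² = c⋆ c` since `c` is `⋆`-fixed: **`exists_finset_norm_classes`** —
`∃ R` finite, every `⋆`-fixed unit `x ∈ L[γ₀]` is `r · (a⋆ a)` with `r ∈ R`, `a ∈ L[γ₀]ˣ` — the (NORMS) hypothesis TOKEN FOR TOKEN.  [Rogawski1990 §3.5: the norm classes
`Kˣ ∕ N(K′ˣ)`; here only finiteness, through squares.]
HC_CM is proved only modulo the printed citations until rung 0 closes; count-neutral.

## References
* [Rogawski1990] J. D. Rogawski, *Automorphic Representations of Unitary Groups in Three Variables*, Ann. of Math. Stud. 123 (1990), §3.5 Prop. 3.5.2 p. 29, §3.6 p. 31.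
* [NeukirchANT1999] J. Neukirch, *Algebraic Number Theory* (1999), Ch. II (5.8) Cor. (finiteness of square classes).
-/

set_option autoImplicit false

noncomputable section

namespace Literature.NumberTheory.Rogawski1990

open scoped MatrixGroups Matrix
open Literature.AlgebraicGeometry.ShimuraVarieties (unitaryGroup mem_unitaryGroup_iff)
open Literature.LinearAlgebra.Matrix Literature.NumberTheory.LocalFields

variable {F L : Type} [Field F] [ValuativeRel F] [TopologicalSpace F] [IsNonarchimedeanLocalField F] [CharZero F]
  [Field L] [Algebra F L] [FiniteDimensional F L] (σ : L →+* L) {N : ℕ} {H : Matrix (Fin N) (Fin N) L}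

/-- **(NORMS) for a Cartan algebra over a local field**: `γ₀ ∈ U(H)(L)` regular semisimple ⇒ finitely many `⋆`-fixed units of `L[γ₀]` modulo norms `a⋆ a`, `a ∈ L[γ₀]ˣ` — the
hypothesis `hNorms` of ★ `exists_finset_cartanSubgroups_of_types_of_norms`, from the square classes of the fixed algebra `L[γ₀]^⋆` (★ (B6)).
[cite: Rogawski1990, §3.5 Prop. 3.5.2 p. 29] [cite: NeukirchANT1999, Ch. II (5.8) Cor.] -/
theorem exists_finset_norm_classes (hσF : ∀ q : F, σ (algebraMap F L q) = algebraMap F L q) (hσσ : ∀ x : L, σ (σ x) = x) (hHdet : IsUnit H.det)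
    (hH : (H.map σ)ᵀ = H) (γ₀ : ↥(unitaryGroup σ H)) (hreg₀ : ((γ₀ : GL (Fin N) L) : Matrix (Fin N) (Fin N) L).charpoly.Separable) :
    ∃ R : Finset (Matrix (Fin N) (Fin N) L), ∀ x ∈ Algebra.adjoin L ({((γ₀ : GL (Fin N) L) : Matrix (Fin N) (Fin N) L)} : Set (Matrix (Fin N) (Fin N) L)),
      hermStar σ H x = x → IsUnit x →
        ∃ r ∈ R, ∃ a : GL (Fin N) L, (a : Matrix (Fin N) (Fin N) L) ∈ Algebra.adjoin L ({((γ₀ : GL (Fin N) L) : Matrix (Fin N) (Fin N) L)} : Set (Matrix (Fin N) (Fin N) L)) ∧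
          x = r * (hermStar σ H (a : Matrix (Fin N) (Fin N) L) * (a : Matrix (Fin N) (Fin N) L)) := by
  classical
  have hγ₀ : ((((γ₀ : GL (Fin N) L) : Matrix (Fin N) (Fin N) L)).map σ)ᵀ * H * ((γ₀ : GL (Fin N) L) : Matrix (Fin N) (Fin N) L) = H := mem_unitaryGroup_iff.1 γ₀.2
  -- the Cartan algebra `B = L[γ₀]`, its involution `τ`, its fixed algebra `K`
  set B : Subalgebra L (Matrix (Fin N) (Fin N) L) := Algebra.adjoin L ({((γ₀ : GL (Fin N) L) : Matrix (Fin N) (Fin N) L)} : Set (Matrix (Fin N) (Fin N) L)) with hB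
  let τ : ↥B ≃ₐ[F] ↥B := cartanInvolution σ hσF hσσ hHdet hH hreg₀ hγ₀
  have hτ : ∀ b : ↥B, ((τ b : ↥B) : Matrix (Fin N) (Fin N) L) = hermStar σ H (b : Matrix (Fin N) (Fin N) L) := fun b =>
    coe_cartanInvolution σ hσF hσσ hHdet hH hreg₀ hγ₀ b
  let K : Subalgebra F ↥B := AlgHom.equalizer (τ : ↥B →ₐ[F] ↥B) (AlgHom.id F ↥B)
  have hKmem : ∀ {b : ↥B}, b ∈ K ↔ hermStar σ H (b : Matrix (Fin N) (Fin N) L) = b := fun {b} => by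
    rw [AlgHom.mem_equalizer]
    constructor
    · intro h; rw [← hτ, show τ b = b from h]
    · intro h
      show (τ : ↥B →ₐ[F] ↥B) b = AlgHom.id F ↥B b
      exact Subtype.ext (by rw [AlgHom.id_apply]; exact (hτ b).trans h)
  -- `K` is a reduced, finite-dimensional, COMMUTATIVE `F`-algebra
  haveI : IsReduced ↥B := isReduced_adjoin_singleton _ hreg₀
  haveI : IsReduced ↥K := isReduced_of_injective K.val Subtype.coe_injective
  haveI : FiniteDimensional F (Matrix (Fin N) (Fin N) L) := Module.Finite.trans L _
  haveI : FiniteDimensional F ↥B :=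
    FiniteDimensional.of_injective ((B.val.restrictScalars F).toLinearMap) Subtype.coe_injective
  haveI : FiniteDimensional F ↥K := FiniteDimensional.of_injective (K.val.toLinearMap) Subtype.coe_injective
  have hBc : IsMulCommutative ↥B := Algebra.isMulCommutative_adjoin L (fun x hx y hy => by rw [Set.mem_singleton_iff] at hx hy; rw [hx, hy])
  letI : CommRing ↥K := { (inferInstance : Ring ↥K) with mul_comm := fun x y => Subtype.ext (hBc.is_comm.comm (x : ↥B) (y : ↥B)) }
  -- finitely many square classes in `Kˣ`
  obtain ⟨T, hT⟩ := exists_finset_units_forall_eq_mul_sq F ↥K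
  refine ⟨T.image (fun t : (↥K)ˣ => (((t : ↥K) : ↥B) : Matrix (Fin N) (Fin N) L)), fun x hx hxs hxu => ?_⟩
  -- `x` as a unit of `K`
  have hxi : IsUnit x.det := (Matrix.isUnit_iff_isUnit_det x).1 hxu
  have hinv_mem : x⁻¹ ∈ B := mem_adjoin_singleton_of_commute _ hreg₀ (by
    have hc := (commute_of_mem_adjoin_singleton hx).symm   -- `Commute γ₀ x`
    calc ((γ₀ : GL (Fin N) L) : Matrix (Fin N) (Fin N) L) * x⁻¹ = x⁻¹ * (x * ((γ₀ : GL (Fin N) L) : Matrix (Fin N) (Fin N) L)) * x⁻¹ := by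
          rw [← Matrix.mul_assoc, Matrix.nonsing_inv_mul x hxi, Matrix.one_mul]
      _ = x⁻¹ * ((γ₀ : GL (Fin N) L) : Matrix (Fin N) (Fin N) L) := by
          rw [← hc.eq, Matrix.mul_assoc, Matrix.mul_assoc, Matrix.mul_nonsing_inv x hxi, Matrix.mul_one])
  have hinv_star : hermStar σ H x⁻¹ = x⁻¹ := by
    -- `(x⁻¹)⋆ x = (x⁻¹)⋆ x⋆ = (x x⁻¹)⋆ = 1`
    have h1 : hermStar σ H x⁻¹ * x = 1 := by
      calc hermStar σ H x⁻¹ * x = hermStar σ H x⁻¹ * hermStar σ H x := by rw [hxs]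
        _ = hermStar σ H (x * x⁻¹) := (hermStar_mul σ H hHdet _ _).symm
        _ = 1 := by rw [Matrix.mul_nonsing_inv x hxi, hermStar_one σ H hHdet]
    exact (Matrix.inv_eq_left_inv h1).symm
  let xK : ↥K := ⟨⟨x, hx⟩, hKmem.2 hxs⟩
  let xiK : ↥K := ⟨⟨x⁻¹, hinv_mem⟩, hKmem.2 hinv_star⟩
  have hxx : xK * xiK = 1 := Subtype.ext (Subtype.ext (Matrix.mul_nonsing_inv x hxi))
  have hxx' : xiK * xK = 1 := Subtype.ext (Subtype.ext (Matrix.nonsing_inv_mul x hxi))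
  let xU : (↥K)ˣ := ⟨xK, xiK, hxx, hxx'⟩
  obtain ⟨t, htT, c, hxtc⟩ := hT xU
  -- read the identity `x = t · c²` in matrices
  have hval : x = (((t : ↥K) : ↥B) : Matrix (Fin N) (Fin N) L) * ((((c : ↥K) : ↥B) : Matrix (Fin N) (Fin N) L) * (((c : ↥K) : ↥B) : Matrix (Fin N) (Fin N) L)) := by
    have h : ((xU : ↥K) : ↥B) = (((t * c ^ 2 : (↥K)ˣ) : ↥K) : ↥B) := by rw [hxtc]
    have h' : (((xU : ↥K) : ↥B) : Matrix (Fin N) (Fin N) L) = x := rfl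
    rw [← h', h]
    simp only [Units.val_mul, pow_two, Subalgebra.coe_mul]
  -- `c` is `⋆`-fixed, so `c² = c⋆ c`; `c` is a unit matrix
  have hcs : hermStar σ H (((c : ↥K) : ↥B) : Matrix (Fin N) (Fin N) L) = (((c : ↥K) : ↥B) : Matrix (Fin N) (Fin N) L) := hKmem.1 (c : ↥K).2
  have hcunit : IsUnit ((((c : ↥K) : ↥B) : Matrix (Fin N) (Fin N) L)) := by
    have h := congrArg (fun u : ↥K => ((u : ↥B) : Matrix (Fin N) (Fin N) L)) c.mul_inv
    simp only [Subalgebra.coe_mul, Subalgebra.coe_one] at h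
    exact (Matrix.isUnit_iff_isUnit_det _).2 (Matrix.isUnit_det_of_right_inverse h)
  refine ⟨_, Finset.mem_image_of_mem (fun t : (↥K)ˣ => (((t : ↥K) : ↥B) : Matrix (Fin N) (Fin N) L)) htT, hcunit.unit, ?_, ?_⟩
  · rw [IsUnit.unit_spec]; exact ((c : ↥K) : ↥B).2
  · rw [IsUnit.unit_spec, hcs]; exact hval

end Literature.NumberTheory.Rogawski1990

end
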